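import Literature.AlgebraicGeometry.Pohlmann1968.CMTypeRankCharactersNumberField
import Literature.AlgebraicGeometry.Pohlmann1968.NondegenerateCMTypeHodgeConjecture
import Literature.AlgebraicGeometry.ComplexMultiplication.SimpleIffPrimitiveCMType
import Mathlib.NumberTheory.NumberField.CMField
import Mathlib.RingTheory.Polynomial.Cyclotomic.Roots
import Mathlib.FieldTheory.Minpoly.Field
import HarnessLib

/-!
# CM fields with cyclic Galois group of `2`-power order: EVERY CM type is nondegenerate (and primitive) —
# the Hodge conjecture for all powers of every abelian variety with complex multiplication by such a field

COR-CM (cell `pub-hodgecm2`), binder seat b04 (gen 11), count-neutral sequel of the claim CYCLO-RANK-CENSUS: the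
STRUCTURAL reason behind the kernel censuses `CorCM/CyclotomicRankCensusSeventeen` (`ℚ(ζ₁₇)`: all `256` types of
rank `9`) and the classical `ℚ(ζ₅)`.  KERNEL ONLY: theorems; no definition, no named fact, no `sorry`.

THEOREM (`isNondegenerate_of_isCyclic`).  Let `K` be a CM field, normal over `ℚ`, whose Galois group is CYCLIC of
order `2^{k+1}` (e.g. `ℚ(ζ_p)` for a Fermat prime `p = 5, 17, 257, 65537`; the cyclic quartic, octic, … CM fields
such as the `C₈` field of conductor `32`).  Then EVERY CM type `Φ` of `K` is NONDEGENERATE (Kubota rank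
`2^k + 1`), hence primitive; every abelian variety `(A, ι, θ)` realising `(K; Φ)` is simple of dimension `2^k`, has
`Bᵐ(Aⁿ) ⊗ ℂ = Dᵐ(Aⁿ) ⊗ ℂ` and satisfies the Hodge conjecture together with all its powers — UNCONDITIONALLY
(`hodgeConjectureFor_pow_of_isCyclic`).

PROOF (elementary; presearch: not found in this form in Dodson 1984/1987, Kubota 1965, Lang, Ribet — Dodson 1984
Prop. 5.2.2 records the case `G = ℤ/8`: "`2⁴ = 8 + 8`, each orbit being primitive").  By Kubota's Lemma 2 (tree
theorem `Pohlmann1968.isNondegenerate_iff_forall_oddCharacters`) it suffices that no ODD character `χ` of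
`G = Gal(K/ℚ)` (`χ(ρ) = -1`, `ρ` = complex conjugation) vanishes on `{g | σ_g ∈ Φ}`.  Let `γ` generate `G`,
`|G| = 2m`, `m = 2^k`, `ω = χ(γ)`.  The involution `ρ` is `γ^m` (the only involution of a cyclic group), so
`ω^m = χ(ρ) = -1`: `ω` is a root of `X^m + 1 = Φ_{2m}(X)`, irreducible over `ℚ`, which is therefore its minimal
polynomial (degree `m`).  The type contains exactly one of `γ^i`, `γ^{i+m} = ργ^i` for each `i < m`, and
`ω^{i+m} = -ω^i`, so `Σ_{g ∈ Φ} χ(g) = Σ_{i<m} ε_i ω^i` with ALL `ε_i = ±1`: a NONZERO rational polynomial of degree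
`< m` evaluated at `ω` — which cannot vanish.  (For a cyclic group of order `2m` with `m` NOT a power of `2` the
argument breaks exactly where it should: `1, ω, …, ω^{m-1}` are then linearly dependent, and e.g. `ℚ(ζ₇)`, `ℚ(ζ₁₃)`
have imprimitive types.)  §1 is the character-sum lemma for an abstract finite group with a generator of order
`2^{k+1}`; §2 the number-field theorem and its Hodge consequences.

## References

* [Kubota1965] T. Kubota, *On the field extension by complex multiplication*, Trans. AMS 118 (1965), §4 Lemma 2.
* [Gordon1999HodgeAVSurvey] B. B. Gordon, *A survey of the Hodge conjecture for abelian varieties*, Prop. 9.4.1,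
  Thm. 6.4, §9.3.
* [Dodson1984] B. Dodson, *The structure of Galois groups of CM-fields*, Trans. AMS 283 (1984), Prop. 5.2.2.
* [Shimura1998] G. Shimura, *Abelian Varieties with Complex Multiplication and Modular Functions*, §8.2 Prop. 26,
  §18.2 Lemma.
-/

noncomputable section

open CategoryTheory CategoryTheory.Limits NumberField Polynomial

namespace Summit.HodgeConjecture.CorCM.CyclicTwoPower

open Literature.NumberTheory.ComplexMultiplication
open Literature.AlgebraicGeometry.Motives (AbelianVariety CMType)
open Literature.AlgebraicGeometry.HodgeTheory
open Literature.AlgebraicGeometry.ComplexMultiplication (IsCMTypeRealisation isSimple_iff_isPrimitive)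
open Literature.AlgebraicGeometry.VanGeemen1994 (hodgeClassSpan)
open Literature.Barriers.HodgeConjecture (divisorClassesSpan)
open Literature.AlgebraicGeometry.Pohlmann1968

/-! ### §1 Odd characters of a cyclic group of order `2^{k+1}` do not vanish on a CM type -/

section Group

variable {G : Type*} [Group G] [Fintype G] [DecidableEq G]

omit [Fintype G] [DecidableEq G] in
/-- In a group generated by `γ` of order `2m`, an involution `ρ ≠ 1` is `γ^m`. [folklore] -/
theorem involution_eq_pow {γ ρ : G} {m : ℕ} (hγ : orderOf γ = 2 * m)
    (hgen : ∀ x : G, x ∈ Submonoid.powers γ) (hρ1 : ρ ≠ 1) (hρ2 : ρ * ρ = 1) : ρ = γ ^ m := by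
  obtain ⟨e, rfl⟩ := (Submonoid.mem_powers_iff _ _).1 (hgen ρ)
  -- `γ^(2e) = 1`, so `2m ∣ 2e`, `m ∣ e`
  have h2e : orderOf γ ∣ 2 * e := by
    rw [orderOf_dvd_iff_pow_eq_one, two_mul, pow_add, hρ2]
  rw [hγ] at h2e
  obtain ⟨q, hq⟩ := Nat.dvd_of_mul_dvd_mul_left (by norm_num : 0 < 2) h2e
  have hδ2 : (γ ^ m) ^ 2 = 1 := by
    rw [← pow_mul, ← orderOf_dvd_iff_pow_eq_one, hγ, mul_comm]
  rw [hq, pow_mul, pow_eq_pow_mod q hδ2]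
  rcases Nat.mod_two_eq_zero_or_one q with h0 | h1
  · exfalso
    apply hρ1
    rw [hq, pow_mul, pow_eq_pow_mod q hδ2, h0, pow_zero]
  · rw [h1, pow_one]

/-- **No odd character vanishes on a CM type of a cyclic group of order `2^{k+1}`.**  For `γ` of order `2^{k+1}`
generating `G`, a CM type `Φ` for the involution `ρ` (one of `x, ρx` for every `x`) and a character `χ` with
`χ(ρ) = -1`: `Σ_{s ∈ Φ} χ(s) = Σ_{i < 2^k} ±χ(γ)^i ≠ 0`, since `χ(γ)` is a root of the irreducible `X^{2^k} + 1`.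
[cite: Kubota1965, §4 Lemma 2] -/
theorem sum_ne_zero_of_orderOf_eq_two_pow {γ ρ : G} {k : ℕ} (hγ : orderOf γ = 2 ^ (k + 1))
    (hgen : ∀ x : G, x ∈ Submonoid.powers γ) {Φ : Finset G} (hΦ : IsCMTypeWith ρ (Φ : Set G))
    (χ : AddChar (Additive G) ℂ) (hχ : χ (Additive.ofMul ρ) = -1) :
    ∑ s ∈ Φ, χ (Additive.ofMul s) ≠ 0 := by
  classical
  set m : ℕ := 2 ^ k with hm_def
  have hm : 0 < m := by positivity
  have hγm : orderOf γ = 2 * m := by rw [hγ, hm_def, pow_succ, mul_comm]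
  -- the involution
  have hρ1 : ρ ≠ 1 := by
    intro h
    have := hΦ.rho_smul_ne (1 : G)
    rw [h, smul_eq_mul, one_mul] at this
    exact this rfl
  have hρ2 : ρ * ρ = 1 := by
    have := hΦ.invol (1 : G)
    simpa [smul_eq_mul] using this
  have hρ : ρ = γ ^ m := involution_eq_pow hγm hgen hρ1 hρ2
  -- `ω = χ(γ)`, `χ(γ^e) = ω^e`, `ω^m = -1`
  set ω : ℂ := χ (Additive.ofMul γ) with hω_def
  have hχpow : ∀ e : ℕ, χ (Additive.ofMul (γ ^ e)) = ω ^ e := fun e => by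
    rw [ofMul_pow, AddChar.map_nsmul_eq_pow]
  have hωm : ω ^ m = -1 := by rw [← hχpow, ← hρ, hχ]
  -- `X^m + 1` is the minimal polynomial of `ω`
  have hcyc : cyclotomic (2 ^ (k + 1)) ℚ = X ^ m + 1 := by
    rw [cyclotomic_prime_pow_eq_geom_sum Nat.prime_two, Finset.sum_range_succ, Finset.sum_range_one, pow_zero,
      pow_one, add_comm]
  have hroot : aeval ω (cyclotomic (2 ^ (k + 1)) ℚ) = 0 := by
    rw [hcyc, map_add, map_pow, aeval_X, map_one, hωm, neg_add_cancel]
  have hmin : minpoly ℚ ω = X ^ m + 1 := by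
    rw [← hcyc]
    exact (minpoly.eq_of_irreducible_of_monic (cyclotomic.irreducible_rat (by positivity)) hroot
      (cyclotomic.monic _ _)).symm
  -- the signs `ε_i` and the polynomial `P = Σ ε_i X^i`
  let ε : ℕ → ℚ := fun i => if γ ^ i ∈ Φ then 1 else -1
  have hε : ∀ i, ε i ≠ 0 := fun i => by
    simp only [ε]; split_ifs <;> norm_num
  let P : ℚ[X] := ∑ i ∈ Finset.range m, monomial i (ε i)
  have hPdeg : P.natDegree < m := by
    have h1 : P.natDegree ≤ m - 1 :=
      natDegree_sum_le_of_forall_le _ _ fun i hi =>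
        (natDegree_monomial_le _).trans (by have := Finset.mem_range.1 hi; omega)
    omega
  have hP0 : P ≠ 0 := by
    intro h
    have h0 : P.coeff 0 = ε 0 := by
      simp only [P, finsetSum_coeff, coeff_monomial]
      rw [Finset.sum_eq_single 0 (fun i _ hi => if_neg hi) (fun h => absurd (Finset.mem_range.2 hm) h), if_pos rfl]
    rw [h, coeff_zero] at h0
    exact hε 0 h0.symm
  have hPeval : aeval ω P = ∑ i ∈ Finset.range m, (ε i : ℂ) * ω ^ i := by
    simp only [P, map_sum, aeval_monomial, eq_ratCast]
  -- the sum over `Φ` equals `P(ω)`: reindex `G` by `Fin m ⊕ Fin m`, `(i) ↦ γ^i`, `(i) ↦ γ^(i+m)`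
  have hcardG : Fintype.card G = 2 * m := by
    have h := orderOf_eq_card_of_forall_mem_powers hgen
    rw [Nat.card_eq_fintype_card] at h
    rw [← h, hγm]
  let e : Fin m ⊕ Fin m → G := fun x => Sum.elim (fun i : Fin m => γ ^ (i : ℕ)) (fun i : Fin m => γ ^ ((i : ℕ) + m)) x
  have hinj : Function.Injective e := by
    have key : ∀ a b : ℕ, a < 2 * m → b < 2 * m → γ ^ a = γ ^ b → a = b := fun a b ha hb hab =>
      pow_injOn_Iio_orderOf (by rw [Set.mem_Iio, hγm]; exact ha) (by rw [Set.mem_Iio, hγm]; exact hb) hab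
    rintro (a | a) (b | b) hab <;> simp only [e, Sum.elim_inl, Sum.elim_inr] at hab
    · exact congrArg Sum.inl (Fin.ext (key _ _ (by omega) (by omega) hab))
    · have := key _ _ (by omega) (by omega) hab; omega
    · have := key _ _ (by omega) (by omega) hab; omega
    · exact congrArg Sum.inr (Fin.ext (by have := key _ _ (by omega) (by omega) hab; omega))
  have hbij : Function.Bijective e := by
    rw [Fintype.bijective_iff_injective_and_card]
    exact ⟨hinj, by rw [Fintype.card_sum, Fintype.card_fin, hcardG, two_mul]⟩
  have hsum : ∑ s ∈ Φ, χ (Additive.ofMul s) = ∑ i ∈ Finset.range m, (ε i : ℂ) * ω ^ i := by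
    have h1 : ∑ s ∈ Φ, χ (Additive.ofMul s) = ∑ g : G, if g ∈ Φ then χ (Additive.ofMul g) else 0 := by
      rw [← Finset.sum_filter, Finset.filter_mem_eq_inter, Finset.univ_inter]
    have h2 : (∑ g : G, if g ∈ Φ then χ (Additive.ofMul g) else 0) =
        ∑ x : Fin m ⊕ Fin m, if e x ∈ Φ then χ (Additive.ofMul (e x)) else 0 :=
      (Fintype.sum_bijective e hbij (fun x => if e x ∈ Φ then χ (Additive.ofMul (e x)) else 0)
        (fun g => if g ∈ Φ then χ (Additive.ofMul g) else 0) fun _ => rfl).symm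
    have h3 : ∀ i : Fin m, (γ ^ ((i : ℕ) + m) ∈ Φ ↔ γ ^ (i : ℕ) ∉ Φ) := fun i => by
      have h := hΦ.rho_smul_mem_iff (γ ^ (i : ℕ))
      rw [smul_eq_mul, hρ, ← pow_add, add_comm, Finset.mem_coe, Finset.mem_coe] at h
      exact h
    rw [h1, h2, Fintype.sum_sum_type, ← Finset.sum_add_distrib, Finset.sum_range]
    refine Finset.sum_congr rfl fun i _ => ?_
    change ((if γ ^ (i : ℕ) ∈ Φ then χ (Additive.ofMul (γ ^ (i : ℕ))) else 0) +
        if γ ^ ((i : ℕ) + m) ∈ Φ then χ (Additive.ofMul (γ ^ ((i : ℕ) + m))) else 0) = (ε i : ℂ) * ω ^ (i : ℕ)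
    rw [hχpow ((i : ℕ) + m), hχpow (i : ℕ), pow_add ω (i : ℕ) m, hωm]
    by_cases hi : γ ^ (i : ℕ) ∈ Φ
    · have hi' : γ ^ ((i : ℕ) + m) ∉ Φ := fun h => (h3 i).1 h hi
      simp only [hi, hi', if_true, if_false, ε]
      push_cast; ring
    · have hi' : γ ^ ((i : ℕ) + m) ∈ Φ := (h3 i).2 hi
      simp only [hi, hi', if_true, if_false, ε]
      push_cast; ring
  -- conclusion: `P(ω) ≠ 0`
  rw [hsum, ← hPeval]
  intro h0
  have hle := minpoly.degree_le_of_ne_zero ℚ ω hP0 h0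
  rw [hmin, show (X ^ m + 1 : ℚ[X]) = X ^ m + C 1 by rw [C_1], degree_X_pow_add_C hm] at hle
  have hlt : P.degree < (m : WithBot ℕ) := degree_le_natDegree.trans_lt (by exact_mod_cast hPdeg)
  exact absurd hle (not_le.2 hlt)

end Group

/-! ### §2 CM fields with cyclic Galois group of `2`-power order -/

section Field

variable {K : Type} [Field K] [NumberField K] [IsCMField K] [Normal ℚ K]

omit [Normal ℚ K] in
/-- Complex conjugation of the CM field `K` as an element of `Gal(K/ℚ)` (Mathlib's `IsCMField.complexConj`), with
`φ ∘ ρ = conj ∘ φ` for EVERY complex embedding `φ`. [cite: Shimura1998, §18.2 Lemma (i)] -/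
theorem exists_conj_gal : ∃ ρ : K ≃ₐ[ℚ] K, ∀ (φ : K →+* ℂ) (x : K), φ (ρ x) = starRingEnd ℂ (φ x) :=
  ⟨AlgEquiv.ofRingEquiv (f := (IsCMField.complexConj K).toRingEquiv) fun q => by simp,
    fun φ x => IsCMField.complexEmbedding_complexConj K φ x⟩

/-- **Every CM type of a CM field with CYCLIC Galois group of order `2^{k+1}` is nondegenerate** (Kubota rank
`2^k + 1`). [cite: Kubota1965, §4 Lemma 2] [cite: Dodson1984, Prop. 5.2.2] -/
theorem isNondegenerate_of_isCyclic (hcyc : IsCyclic (K ≃ₐ[ℚ] K)) {k : ℕ}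
    (hK : Module.finrank ℚ K = 2 ^ (k + 1)) (Φ : CMType K) : IsNondegenerate Φ := by
  classical
  obtain ⟨γ, hγgen⟩ := hcyc.exists_generator
  have hgen : ∀ x : K ≃ₐ[ℚ] K, x ∈ Submonoid.powers γ := fun x => mem_powers_iff_mem_zpowers.2 (hγgen x)
  have hcomm : ∀ g h : K ≃ₐ[ℚ] K, g * h = h * g := fun g h => by
    obtain ⟨a, rfl⟩ := (Submonoid.mem_powers_iff _ _).1 (hgen g)
    obtain ⟨b, rfl⟩ := (Submonoid.mem_powers_iff _ _).1 (hgen h)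
    rw [← pow_add, ← pow_add, add_comm]
  obtain ⟨φ₀⟩ := (inferInstance : Nonempty (K →+* ℂ))
  obtain ⟨ρ, hρ⟩ := exists_conj_gal (K := K)
  rw [isNondegenerate_iff_forall_oddCharacters hcomm Φ φ₀ ρ (hρ φ₀)]
  intro χ hχ
  have hcard : Fintype.card (K ≃ₐ[ℚ] K) = 2 ^ (k + 1) := by
    rw [Fintype.card_congr (Equiv.ofBijective (embOf φ₀) (embOf_bijective φ₀)), NumberField.Embeddings.card, hK]
  have hγ : orderOf γ = 2 ^ (k + 1) := by
    rw [orderOf_eq_card_of_forall_mem_zpowers hγgen, Nat.card_eq_fintype_card, hcard]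
  have hset : ({g : K ≃ₐ[ℚ] K | embOf φ₀ g ∈ Φ.1} : Set (K ≃ₐ[ℚ] K)) =
      ↑(Finset.univ.filter fun g : K ≃ₐ[ℚ] K => embOf φ₀ g ∈ Φ.1) := by
    ext g; simp
  have hcm := isCMTypeWith_gal hcomm Φ φ₀ ρ (hρ φ₀)
  rw [hset] at hcm
  exact sum_ne_zero_of_orderOf_eq_two_pow hγ hgen hcm χ hχ

/-- **… hence of Kubota rank `2^k + 1`, and PRIMITIVE** (Kubota: nondegenerate ⟹ primitive).
[cite: Kubota1965, §2 (p. 115) and §4 Lemma 2] -/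
theorem cmTypeRank_eq_and_isPrimitive_of_isCyclic (hcyc : IsCyclic (K ≃ₐ[ℚ] K)) {k : ℕ}
    (hK : Module.finrank ℚ K = 2 ^ (k + 1)) (Φ : CMType K) (φ₀ : K →+* ℂ) :
    cmTypeRank Φ = 2 ^ k + 1 ∧ IsPrimitive (ℂ ≃+* ℂ) Φ.1 φ₀ := by
  have h := isNondegenerate_of_isCyclic hcyc hK Φ
  refine ⟨?_, h.isPrimitive φ₀⟩
  rw [isNondegenerate_iff, hK, pow_succ, Nat.mul_div_cancel _ (by norm_num : 0 < 2)] at h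
  exact h

variable {Φ : CMType K} {A : AbelianVariety ℂ} {ι : 𝓞 K →+* End A} {θ : K →+* Module.End ℂ (complexBetti A.X 1)}

/-- **Every realisation of a CM type of such a field is a SIMPLE abelian variety of dimension `2^k`.**
[cite: Shimura1998, §8.2 Prop. 26, §6.2 Thm. 3] -/
theorem isSimple_and_dim_of_isCyclic (hcyc : IsCyclic (K ≃ₐ[ℚ] K)) {k : ℕ}
    (hK : Module.finrank ℚ K = 2 ^ (k + 1)) (hA : IsCMTypeRealisation Φ A ι θ) : A.IsSimple ∧ A.dim = 2 ^ k := by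
  obtain ⟨s₀⟩ := (inferInstance : Nonempty (K →+* ℂ))
  refine ⟨(isSimple_iff_isPrimitive hA s₀).2 (cmTypeRank_eq_and_isPrimitive_of_isCyclic hcyc hK Φ s₀).2, ?_⟩
  have h : A.dim = Module.finrank ℚ K / 2 := Literature.AlgebraicGeometry.Motives.schemeDim_eq_holds hA.1
  rw [hK, pow_succ, Nat.mul_div_cancel _ (by norm_num : 0 < 2)] at h
  exact h

/-- **`Bᵐ(Aⁿ) ⊗ ℂ = Dᵐ(Aⁿ) ⊗ ℂ` on every power of EVERY abelian variety with CM by a CM field with cyclic Galois group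
of `2`-power order** (any CM type, any realisation). [cite: Gordon1999HodgeAVSurvey, Thm. 6.4 and §9.3] -/
theorem hodgeClassSpan_pow_eq_divisorClassesSpan_of_isCyclic (hcyc : IsCyclic (K ≃ₐ[ℚ] K)) {k : ℕ}
    (hK : Module.finrank ℚ K = 2 ^ (k + 1)) (hA : IsCMTypeRealisation Φ A ι θ) (n m : ℕ) :
    hodgeClassSpan (⨁ fun _ : Fin n => A).dim (⨁ fun _ : Fin n => A).X m =
      divisorClassesSpan (⨁ fun _ : Fin n => A).X (⨁ fun _ : Fin n => A).dim m :=
  (isNondegenerate_of_isCyclic hcyc hK Φ).hodgeClassSpan_pow_eq_divisorClassesSpan hA n m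

/-- **The Hodge conjecture for every power `Aⁿ` of EVERY abelian variety with CM by a CM field with cyclic Galois
group of order `2^{k+1}`** (Fermat-prime cyclotomic fields `ℚ(ζ₅), ℚ(ζ₁₇), ℚ(ζ₂₅₇), ℚ(ζ₆₅₅₃₇)`; cyclic quartic,
octic, … CM fields) — UNCONDITIONAL, no simplicity or primitivity hypothesis.
[cite: Gordon1999HodgeAVSurvey, Thm. 6.4 and §9.3] [cite: Deligne2000, §1] -/
theorem hodgeConjectureFor_pow_of_isCyclic (hcyc : IsCyclic (K ≃ₐ[ℚ] K)) {k : ℕ}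
    (hK : Module.finrank ℚ K = 2 ^ (k + 1)) (hA : IsCMTypeRealisation Φ A ι θ) (n : ℕ) :
    HodgeConjectureFor (⨁ fun _ : Fin n => A).dim (⨁ fun _ : Fin n => A).X :=
  (isNondegenerate_of_isCyclic hcyc hK Φ).hodgeConjectureFor_pow hA n

/-- **The Hodge conjecture for EVERY abelian variety with CM by a CM field with cyclic Galois group of order
`2^{k+1}`** (`HodgeConjectureFor (2^k) A.X`) — UNCONDITIONAL. [cite: Gordon1999HodgeAVSurvey, §9.3] [cite: Deligne2000, §1] -/
theorem hodgeConjectureFor_of_isCyclic (hcyc : IsCyclic (K ≃ₐ[ℚ] K)) {k : ℕ}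
    (hK : Module.finrank ℚ K = 2 ^ (k + 1)) (hA : IsCMTypeRealisation Φ A ι θ) : HodgeConjectureFor (2 ^ k) A.X := by
  rw [← (isSimple_and_dim_of_isCyclic hcyc hK hA).2]
  exact (isNondegenerate_of_isCyclic hcyc hK Φ).hodgeConjectureFor hA

end Field

end Summit.HodgeConjecture.CorCM.CyclicTwoPower

end
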